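import Summits.QuantumAdvantage.QuantumAdvantage.Theorems.ArithStatLadderEndJuntaRungCounts
import Mathlib.Analysis.SpecialFunctions.Pow.Asymptotics

/-!
# `EndJuntaRung` (stmt-QuantumAdvantage-2426) — Davenport–Heilbronn's mean `2` in every class `mod 2ᵏ`

Route `ArithStatLadder`, support item `EndJuntaRung`. From the two printed inputs of Taniguchi–Thorne
2013 (Duke) at the prime `2`, taken here as EXPLICIT HYPOTHESES in the shape of the named fact
`Literature.NumberTheory.QuadraticFields.tt_threeTorsion_twoAdic` (imaginary halves):

* `hA` — Thm 4 at `2`: `Σ_{-X<D<0, D ≡ rs (8r)} #Cl₃(D) = (2/(rπ²)) X + K X^{5/6} + O_ε(X^{18/23+ε})`;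
* `hB` — Thm 25, `χ (mod 2ᵏ)`, `χ⁶ ≠ 1`: `Σ_{-X<D<0, D ≡ rs (8r)} χ(D/r) (#Cl₃(D) − 1)/2 = O_ε(X^{18/23+ε})`,

this file deduces the "low bits" input of the rung:
* `progression_eventually` — for every `k`, every class `a (mod 2ᵏ)` and every `ε > 0`, eventually in
  `X`: `|Σ_{-X<D<0 fund., D ≡ a (2ᵏ)} (#Cl₃(D) − 2)| ≤ ε X`.

Proof: a class `mod 2ᵏ` (`k ≥ 6`; smaller `k` split into classes `mod 64`) with fundamental
discriminants is a class `D/r ≡ b (mod 2ʲ)` in a type `(r, s)` (`r 2ʲ = 2ᵏ`); by orthogonality of the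
characters `mod 2ʲ` on `D/r` its centred sum is an average of `Σ_{type} χ(D/r)(#Cl₃(D) − 2)`: for `χ`
trivial on the residues `≡ 1 (mod 8)` (constant on the type) this is `O(X^{5/6})` by `hA` and the
Lemma-21 count `X/(rπ²)` (mean EXACTLY `2`); otherwise `χ² ≠ 1` (Hensel), so `χ⁶ ≠ 1` (`2`-group) and
`hB` plus the `O(√X)` character sum `norm_sum_char_type_le` bound it.
-/

noncomputable section

set_option linter.dupNamespace false -- D-0017: single-problem summit ⇒ `QuantumAdvantage.QuantumAdvantage` by design

namespace Summit.QuantumAdvantage.QuantumAdvantage.Theorems.ArithStatLadder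

open Filter Finset
open scoped Topology
open Literature.NumberTheory.QuadraticFields

/-! ## From a power saving to `o(X)` -/

/-- If `|S X| ≤ C X^θ` for `X ≥ 1` with `θ < 1`, then for every `ε > 0` eventually `|S X| ≤ ε X`. -/
theorem eventually_le_mul_of_le_rpow {S : ℕ → ℝ} {C θ : ℝ} (hθ : θ < 1)
    (h : ∀ X : ℕ, 1 ≤ X → |S X| ≤ C * (X : ℝ) ^ θ) {ε : ℝ} (hε : 0 < ε) :
    ∀ᶠ X : ℕ in atTop, |S X| ≤ ε * X := by
  have h1 : Tendsto (fun X : ℕ => (X : ℝ) ^ (-(1 - θ))) atTop (𝓝 0) :=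
    (tendsto_rpow_neg_atTop (by linarith : 0 < 1 - θ)).comp tendsto_natCast_atTop_atTop
  have h2 : Tendsto (fun X : ℕ => C * (X : ℝ) ^ (-(1 - θ))) atTop (𝓝 0) := by
    simpa using h1.const_mul C
  filter_upwards [h2.eventually (eventually_le_nhds hε), eventually_ge_atTop 1] with X hX hX1
  have hX0 : (0:ℝ) < X := by exact_mod_cast hX1
  calc |S X| ≤ C * (X:ℝ) ^ θ := h X hX1
    _ = C * (X:ℝ) ^ (-(1 - θ)) * X := by
        rw [mul_assoc, ← Real.rpow_add_one hX0.ne']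
        ring_nf
    _ ≤ ε * X := by gcongr

/-- Power bookkeeping: for `X ≥ 1`, `X^{18/23 + 1/46} ≤ X^{5/6}` and `√X ≤ X^{5/6}`. -/
theorem rpow_le_rpow_five_sixths {X : ℕ} (hX : 1 ≤ X) :
    (X : ℝ) ^ ((18 : ℝ) / 23 + 1 / 46) ≤ (X : ℝ) ^ ((5 : ℝ) / 6) ∧
      Real.sqrt X ≤ (X : ℝ) ^ ((5 : ℝ) / 6) := by
  have hX1 : (1 : ℝ) ≤ X := by exact_mod_cast hX
  refine ⟨Real.rpow_le_rpow_of_exponent_le hX1 (by norm_num), ?_⟩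
  rw [Real.sqrt_eq_rpow]
  exact Real.rpow_le_rpow_of_exponent_le hX1 (by norm_num)

/-! ## Centred and twisted sums over a `2`-adic type -/

/-- **Mean `2` on a `2`-adic type** (hypothesis `hA` = Taniguchi–Thorne Thm 4 at `2`, with Lemma 21): for an
admissible `(r, s)`, `|Σ_{D ∈ negFundDiscrs X, D ≡ rs (8r)} (#Cl₃(D) − 2)| ≤ C X^{5/6}`. -/
theorem abs_sum_type_sub_two_le
    (hA : ∀ r ∈ ({1, 4, 8} : Finset ℕ), ∀ s ∈ ({1, 3, 5, 7} : Finset ℤ),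
      ttLocalFactorTwo (r * s) = 1 → ∃ K : ℝ, ∀ ε : ℝ, 0 < ε → ∃ C : ℝ, ∀ X : ℕ, 1 ≤ X →
        |(∑ D ∈ (negFundDiscrs X).filter (fun D => D ≡ r * s [ZMOD ((8 * r : ℕ) : ℤ)]),
            (quadFieldThreeTorsion D : ℝ)) - 2 / (r * Real.pi ^ 2) * X
            - K * (X : ℝ) ^ ((5 : ℝ) / 6)| ≤ C * (X : ℝ) ^ ((18 : ℝ) / 23 + ε))
    {r : ℕ} {s : ℤ} (hr : r ∈ ({1, 4, 8} : Finset ℕ)) (hs : s ∈ ({1, 3, 5, 7} : Finset ℤ))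
    (he : ttLocalFactorTwo (r * s) = 1) :
    ∃ C : ℝ, ∀ X : ℕ, 1 ≤ X →
      |∑ D ∈ (negFundDiscrs X).filter (fun D => D ≡ r * s [ZMOD ((8 * r : ℕ) : ℤ)]),
          ((quadFieldThreeTorsion D : ℝ) - 2)| ≤ C * (X : ℝ) ^ ((5 : ℝ) / 6) := by
  obtain ⟨K, hK⟩ := hA r hr s hs he
  obtain ⟨C₁, hC₁⟩ := hK (1 / 46) (by norm_num)
  obtain ⟨C₂, hC₂⟩ := abs_card_type_sub_le hr hs he
  refine ⟨|C₁| + |K| + 2 * |C₂|, fun X hX => ?_⟩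
  obtain ⟨hp1, hp2⟩ := rpow_le_rpow_five_sixths hX
  set P : ℝ := (X : ℝ) ^ ((5 : ℝ) / 6) with hP
  have hP0 : 0 ≤ P := by positivity
  set T := (negFundDiscrs X).filter (fun D => D ≡ r * s [ZMOD ((8 * r : ℕ) : ℤ)]) with hT
  have hsum : ∑ D ∈ T, ((quadFieldThreeTorsion D : ℝ) - 2) =
      ((∑ D ∈ T, (quadFieldThreeTorsion D : ℝ)) - 2 / (r * Real.pi ^ 2) * X - K * P)
        + K * P - 2 * ((T.card : ℝ) - 1 / (r * Real.pi ^ 2) * X) := by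
    rw [Finset.sum_sub_distrib, Finset.sum_const, nsmul_eq_mul]
    ring
  rw [hsum]
  have e1 : |(∑ D ∈ T, (quadFieldThreeTorsion D : ℝ)) - 2 / (r * Real.pi ^ 2) * X - K * P|
      ≤ |C₁| * P :=
    (hC₁ X hX).trans ((mul_le_mul_of_nonneg_right (le_abs_self C₁) (by positivity)).trans
      (mul_le_mul_of_nonneg_left hp1 (abs_nonneg C₁)))
  have e2 : |K * P| ≤ |K| * P := by rw [abs_mul, abs_of_nonneg hP0]
  have e3 : |(T.card : ℝ) - 1 / (r * Real.pi ^ 2) * X| ≤ |C₂| * P :=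
    (hC₂ X hX).trans ((mul_le_mul_of_nonneg_right (le_abs_self C₂) (Real.sqrt_nonneg _)).trans
      (mul_le_mul_of_nonneg_left hp2 (abs_nonneg C₂)))
  obtain ⟨l1, u1⟩ := abs_le.mp e1
  obtain ⟨l2, u2⟩ := abs_le.mp e2
  obtain ⟨l3, u3⟩ := abs_le.mp e3
  rw [abs_le]
  constructor <;> linarith

/-- **Twisted centred sums on a `2`-adic type** (Taniguchi–Thorne Thm 25 at `2` with Lemma 21):
for an admissible `(r, s)`, `k ≥ 6`, `r 2ʲ = 2ᵏ` and a character `χ (mod 2ʲ)` NOT trivial on the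
residues `≡ 1 (mod 8)` (hence `χ⁶ ≠ 1`):
`‖Σ_{D ∈ negFundDiscrs X, D ≡ rs (8r)} χ(D/r) (#Cl₃(D) − 2)‖ ≤ C X^{5/6}`. -/
theorem norm_sum_twist_type_sub_two_le
    (hB : ∀ r ∈ ({1, 4, 8} : Finset ℕ), ∀ s ∈ ({1, 3, 5, 7} : Finset ℤ),
      ttLocalFactorTwo (r * s) = 1 → ∀ (k : ℕ) (χ : DirichletCharacter ℂ (2 ^ k)), χ ^ 6 ≠ 1 →
        ∀ ε : ℝ, 0 < ε → ∃ C : ℝ, ∀ X : ℕ, 1 ≤ X →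
          ‖∑ D ∈ (negFundDiscrs X).filter (fun D => D ≡ r * s [ZMOD ((8 * r : ℕ) : ℤ)]),
              χ (((D / (r : ℤ) : ℤ)) : ZMod (2 ^ k)) * (((quadFieldThreeTorsion D : ℂ) - 1) / 2)‖
            ≤ C * (X : ℝ) ^ ((18 : ℝ) / 23 + ε))
    {r : ℕ} {s : ℤ} (hr : r ∈ ({1, 4, 8} : Finset ℕ)) (hs : s ∈ ({1, 3, 5, 7} : Finset ℤ))
    (he : ttLocalFactorTwo (r * s) = 1) {j k : ℕ} (hk : 6 ≤ k) (hrj : r * 2 ^ j = 2 ^ k)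
    (χ : DirichletCharacter ℂ (2 ^ j)) {u : ℤ} (hu : u % 8 = 1)
    (hχu : χ ((u : ZMod (2 ^ j))) ≠ 1) :
    ∃ C : ℝ, ∀ X : ℕ, 1 ≤ X →
      ‖∑ D ∈ (negFundDiscrs X).filter (fun D => D ≡ r * s [ZMOD ((8 * r : ℕ) : ℤ)]),
          χ (((D / r : ℤ)) : ZMod (2 ^ j)) * ((((quadFieldThreeTorsion D : ℝ) - 2 : ℝ)) : ℂ)‖
        ≤ C * (X : ℝ) ^ ((5 : ℝ) / 6) := by
  have hχ6 : χ ^ 6 ≠ 1 := char_pow_six_ne_one_of_apply_ne_one hu hχu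
  obtain ⟨C₁, hC₁⟩ := hB r hr s hs he j χ hχ6 (1 / 46) (by norm_num)
  obtain ⟨C₂, hC₂⟩ := norm_sum_char_type_le hr hs he hk hrj χ hu hχu
  refine ⟨2 * |C₁| + |C₂|, fun X hX => ?_⟩
  obtain ⟨hp1, hp2⟩ := rpow_le_rpow_five_sixths hX
  set P : ℝ := (X : ℝ) ^ ((5 : ℝ) / 6) with hP
  have hP0 : 0 ≤ P := by positivity
  set T := (negFundDiscrs X).filter (fun D => D ≡ r * s [ZMOD ((8 * r : ℕ) : ℤ)]) with hT
  have hsum : ∑ D ∈ T, χ (((D / r : ℤ)) : ZMod (2 ^ j)) *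
        ((((quadFieldThreeTorsion D : ℝ) - 2 : ℝ)) : ℂ) =
      2 * (∑ D ∈ T, χ (((D / r : ℤ)) : ZMod (2 ^ j)) * (((quadFieldThreeTorsion D : ℂ) - 1) / 2))
        - ∑ D ∈ T, χ (((D / r : ℤ)) : ZMod (2 ^ j)) := by
    rw [Finset.mul_sum, ← Finset.sum_sub_distrib]
    refine Finset.sum_congr rfl fun D _ => ?_
    push_cast
    ring
  rw [hsum]
  have e1 := hC₁ X hX
  have e2 := hC₂ X hX
  calc ‖2 * (∑ D ∈ T, χ (((D / r : ℤ)) : ZMod (2 ^ j)) * (((quadFieldThreeTorsion D : ℂ) - 1) / 2))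
        - ∑ D ∈ T, χ (((D / r : ℤ)) : ZMod (2 ^ j))‖
      ≤ ‖2 * (∑ D ∈ T, χ (((D / r : ℤ)) : ZMod (2 ^ j)) * (((quadFieldThreeTorsion D : ℂ) - 1) / 2))‖
        + ‖∑ D ∈ T, χ (((D / r : ℤ)) : ZMod (2 ^ j))‖ := norm_sub_le _ _
    _ ≤ 2 * (C₁ * (X : ℝ) ^ ((18 : ℝ) / 23 + 1 / 46)) + C₂ * Real.sqrt X := by
        rw [norm_mul, Complex.norm_two]
        gcongr
    _ ≤ 2 * (|C₁| * P) + |C₂| * P := by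
        have h1 : C₁ * (X : ℝ) ^ ((18 : ℝ) / 23 + 1 / 46) ≤ |C₁| * P :=
          (mul_le_mul_of_nonneg_right (le_abs_self C₁) (by positivity)).trans
            (mul_le_mul_of_nonneg_left hp1 (abs_nonneg C₁))
        have h2 : C₂ * Real.sqrt X ≤ |C₂| * P :=
          (mul_le_mul_of_nonneg_right (le_abs_self C₂) (Real.sqrt_nonneg _)).trans
            (mul_le_mul_of_nonneg_left hp2 (abs_nonneg C₂))
        linarith
    _ = (2 * |C₁| + |C₂|) * P := by ring

/-- **Every character term is `O(X^{5/6})`.** For an admissible `(r, s)`, `k ≥ 6`, `r 2ʲ = 2ᵏ`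
and ANY character `χ (mod 2ʲ)`: `‖Σ_{D ∈ negFundDiscrs X, D ≡ rs (8r)} χ(D/r) (#Cl₃(D) − 2)‖ ≤ C X^{5/6}`
— a character trivial on the residues `≡ 1 (mod 8)` is constant (`= χ(s)`) on the type, so the
bound is the centred one; otherwise it is the twisted one. -/
theorem norm_sum_char_type_sub_two_le
    (hA : ∀ r ∈ ({1, 4, 8} : Finset ℕ), ∀ s ∈ ({1, 3, 5, 7} : Finset ℤ),
      ttLocalFactorTwo (r * s) = 1 → ∃ K : ℝ, ∀ ε : ℝ, 0 < ε → ∃ C : ℝ, ∀ X : ℕ, 1 ≤ X →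
        |(∑ D ∈ (negFundDiscrs X).filter (fun D => D ≡ r * s [ZMOD ((8 * r : ℕ) : ℤ)]),
            (quadFieldThreeTorsion D : ℝ)) - 2 / (r * Real.pi ^ 2) * X
            - K * (X : ℝ) ^ ((5 : ℝ) / 6)| ≤ C * (X : ℝ) ^ ((18 : ℝ) / 23 + ε))
    (hB : ∀ r ∈ ({1, 4, 8} : Finset ℕ), ∀ s ∈ ({1, 3, 5, 7} : Finset ℤ),
      ttLocalFactorTwo (r * s) = 1 → ∀ (k : ℕ) (χ : DirichletCharacter ℂ (2 ^ k)), χ ^ 6 ≠ 1 →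
        ∀ ε : ℝ, 0 < ε → ∃ C : ℝ, ∀ X : ℕ, 1 ≤ X →
          ‖∑ D ∈ (negFundDiscrs X).filter (fun D => D ≡ r * s [ZMOD ((8 * r : ℕ) : ℤ)]),
              χ (((D / (r : ℤ) : ℤ)) : ZMod (2 ^ k)) * (((quadFieldThreeTorsion D : ℂ) - 1) / 2)‖
            ≤ C * (X : ℝ) ^ ((18 : ℝ) / 23 + ε))
    {r : ℕ} {s : ℤ} (hr : r ∈ ({1, 4, 8} : Finset ℕ)) (hs : s ∈ ({1, 3, 5, 7} : Finset ℤ))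
    (he : ttLocalFactorTwo (r * s) = 1) {j k : ℕ} (hk : 6 ≤ k) (hrj : r * 2 ^ j = 2 ^ k)
    (χ : DirichletCharacter ℂ (2 ^ j)) :
    ∃ C : ℝ, ∀ X : ℕ, 1 ≤ X →
      ‖∑ D ∈ (negFundDiscrs X).filter (fun D => D ≡ r * s [ZMOD ((8 * r : ℕ) : ℤ)]),
          χ (((D / r : ℤ)) : ZMod (2 ^ j)) * ((((quadFieldThreeTorsion D : ℝ) - 2 : ℝ)) : ℂ)‖
        ≤ C * (X : ℝ) ^ ((5 : ℝ) / 6) := by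
  by_cases hFT : ∀ u : ℤ, u % 8 = 1 → χ ((u : ZMod (2 ^ j))) = 1
  · -- `χ` factors through `mod 8`: constant on the type
    obtain ⟨hr0, hsodd, -, -⟩ := type_arith hr hs
    have hj : 3 ≤ j := three_le_of_mul_two_pow_eq hr hk hrj
    have h8 : (8:ℤ) ∣ 2 ^ j := by
      rw [show (8:ℤ) = 2 ^ 3 by norm_num]; exact pow_dvd_pow 2 hj
    obtain ⟨C, hC⟩ := abs_sum_type_sub_two_le hA hr hs he
    refine ⟨C, fun X hX => ?_⟩
    have hconst : ∀ D ∈ (negFundDiscrs X).filter (fun D => D ≡ r * s [ZMOD ((8 * r : ℕ) : ℤ)]),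
        χ (((D / r : ℤ)) : ZMod (2 ^ j)) = χ ((s : ZMod (2 ^ j))) := by
      intro D hD
      rw [Finset.mem_filter] at hD
      exact char_intCast_eq_of_modEq_eight hFT h8 hsodd (ediv_modEq_of_mem_type hr0 hD.2)
    rw [Finset.sum_congr rfl fun D hD => by rw [hconst D hD], ← Finset.mul_sum, norm_mul,
      ← Complex.ofReal_sum, Complex.norm_real, Real.norm_eq_abs]
    calc ‖χ ((s : ZMod (2 ^ j)))‖ * |∑ D ∈ (negFundDiscrs X).filter
            (fun D => D ≡ r * s [ZMOD ((8 * r : ℕ) : ℤ)]), ((quadFieldThreeTorsion D : ℝ) - 2)|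
        ≤ 1 * (C * (X : ℝ) ^ ((5 : ℝ) / 6)) :=
          mul_le_mul (DirichletCharacter.norm_le_one χ _) (hC X hX) (abs_nonneg _) zero_le_one
      _ = C * (X : ℝ) ^ ((5 : ℝ) / 6) := one_mul _
  · push Not at hFT
    obtain ⟨u, hu, hχu⟩ := hFT
    exact norm_sum_twist_type_sub_two_le hB hr hs he hk hrj χ hu hχu

/-! ## Mean `2` in every class `mod 2ᵏ` -/

/-- **The classes of an admissible type, `k ≥ 6`.** For an admissible `(r, s)`, `r 2ʲ = 2ᵏ`,
`k ≥ 6`, `a = r b` with `b ≡ s (mod 8)` and `ε > 0`: eventually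
`|Σ_{D ∈ negFundDiscrs X, D ≡ a (2ᵏ)} (#Cl₃(D) − 2)| ≤ ε X` (orthogonality of the characters
`mod 2ʲ` on `D/r`, then `norm_sum_char_type_sub_two_le` for each of the finitely many characters). -/
theorem progression_eventually_of_type
    (hA : ∀ r ∈ ({1, 4, 8} : Finset ℕ), ∀ s ∈ ({1, 3, 5, 7} : Finset ℤ),
      ttLocalFactorTwo (r * s) = 1 → ∃ K : ℝ, ∀ ε : ℝ, 0 < ε → ∃ C : ℝ, ∀ X : ℕ, 1 ≤ X →
        |(∑ D ∈ (negFundDiscrs X).filter (fun D => D ≡ r * s [ZMOD ((8 * r : ℕ) : ℤ)]),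
            (quadFieldThreeTorsion D : ℝ)) - 2 / (r * Real.pi ^ 2) * X
            - K * (X : ℝ) ^ ((5 : ℝ) / 6)| ≤ C * (X : ℝ) ^ ((18 : ℝ) / 23 + ε))
    (hB : ∀ r ∈ ({1, 4, 8} : Finset ℕ), ∀ s ∈ ({1, 3, 5, 7} : Finset ℤ),
      ttLocalFactorTwo (r * s) = 1 → ∀ (k : ℕ) (χ : DirichletCharacter ℂ (2 ^ k)), χ ^ 6 ≠ 1 →
        ∀ ε : ℝ, 0 < ε → ∃ C : ℝ, ∀ X : ℕ, 1 ≤ X →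
          ‖∑ D ∈ (negFundDiscrs X).filter (fun D => D ≡ r * s [ZMOD ((8 * r : ℕ) : ℤ)]),
              χ (((D / (r : ℤ) : ℤ)) : ZMod (2 ^ k)) * (((quadFieldThreeTorsion D : ℂ) - 1) / 2)‖
            ≤ C * (X : ℝ) ^ ((18 : ℝ) / 23 + ε))
    {r : ℕ} {s : ℤ} (hr : r ∈ ({1, 4, 8} : Finset ℕ)) (hs : s ∈ ({1, 3, 5, 7} : Finset ℤ))
    (he : ttLocalFactorTwo (r * s) = 1) {j k : ℕ} (hk : 6 ≤ k) (hrj : r * 2 ^ j = 2 ^ k)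
    {a b : ℤ} (hab : a = r * b) (hb : b ≡ s [ZMOD 8]) {ε : ℝ} (hε : 0 < ε) :
    ∀ᶠ X : ℕ in atTop,
      |∑ D ∈ (negFundDiscrs X).filter (fun D => D ≡ a [ZMOD ((2 ^ k : ℕ) : ℤ)]),
          ((quadFieldThreeTorsion D : ℝ) - 2)| ≤ ε * X := by
  obtain ⟨hr0, hsodd, -, -⟩ := type_arith hr hs
  have hj : 3 ≤ j := three_le_of_mul_two_pow_eq hr hk hrj
  haveI : NeZero (2 ^ j) := ⟨by positivity⟩
  subst hab
  -- the characters `mod 2ʲ` and their bounds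
  choose C hC using fun χ : DirichletCharacter ℂ (2 ^ j) =>
    norm_sum_char_type_sub_two_le hA hB hr hs he hk hrj χ
  have hb2 : b % 2 = 1 := by
    have := hb
    rw [Int.ModEq] at this
    omega
  have hcop : IsCoprime b ((2 ^ j : ℕ) : ℤ) := by
    have h2 : IsCoprime (2:ℤ) b := by
      rw [Prime.coprime_iff_not_dvd Int.prime_two]; omega
    push_cast
    exact h2.symm.pow_right
  -- the bound `φ(2ʲ)⁻¹ Σ_χ C χ · X^{5/6}` for `X ≥ 1`
  refine eventually_le_mul_of_le_rpow (θ := (5 : ℝ) / 6) (by norm_num)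
    (C := ((2 ^ j : ℕ).totient : ℝ)⁻¹ * ∑ χ : DirichletCharacter ℂ (2 ^ j), C χ) ?_ hε
  intro X hX
  rw [show (((2 ^ k : ℕ) : ℤ)) = ((r * 2 ^ j : ℕ) : ℤ) by rw [hrj],
    filter_modEq_mul_eq_filter_type hr0 s hj hb]
  set T := (negFundDiscrs X).filter (fun D => D ≡ r * s [ZMOD ((8 * r : ℕ) : ℤ)]) with hT
  have horth := sum_filter_modEq_apply_eq_sum_char hcop T (fun D => D / r)
    (fun D => ((((quadFieldThreeTorsion D : ℝ) - 2 : ℝ)) : ℂ))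
  have hreal : |∑ D ∈ T.filter (fun D => D / r ≡ b [ZMOD ((2 ^ j : ℕ) : ℤ)]),
      ((quadFieldThreeTorsion D : ℝ) - 2)| =
      ‖∑ D ∈ T.filter (fun D => D / r ≡ b [ZMOD ((2 ^ j : ℕ) : ℤ)]),
        ((((quadFieldThreeTorsion D : ℝ) - 2 : ℝ)) : ℂ)‖ := by
    rw [← Complex.ofReal_sum, Complex.norm_real, Real.norm_eq_abs]
  rw [hreal, horth, norm_mul, norm_inv, Complex.norm_natCast, mul_assoc]
  have hφpos : (0 : ℝ) < ((2 ^ j : ℕ).totient : ℝ) := by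
    exact_mod_cast Nat.totient_pos.2 (by positivity)
  refine mul_le_mul_of_nonneg_left ?_ (inv_nonneg.2 hφpos.le)
  refine (norm_sum_le _ _).trans ?_
  rw [Finset.sum_mul]
  refine Finset.sum_le_sum fun χ _ => ?_
  rw [norm_mul]
  calc ‖χ (b : ZMod (2 ^ j))⁻¹‖ * ‖∑ D ∈ T, χ (((D / r : ℤ)) : ZMod (2 ^ j)) *
          ((((quadFieldThreeTorsion D : ℝ) - 2 : ℝ)) : ℂ)‖
      ≤ 1 * ‖∑ D ∈ T, χ (((D / r : ℤ)) : ZMod (2 ^ j)) *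
          ((((quadFieldThreeTorsion D : ℝ) - 2 : ℝ)) : ℂ)‖ :=
        mul_le_mul_of_nonneg_right (DirichletCharacter.norm_le_one χ _) (norm_nonneg _)
    _ ≤ C χ * (X : ℝ) ^ ((5 : ℝ) / 6) := by rw [one_mul]; exact hC χ X hX

/-- **Mean `2` in every class `mod 2ᵏ`, `k ≥ 6`.** For `k ≥ 6`, every `a` and every `ε > 0`:
eventually `|Σ_{D ∈ negFundDiscrs X, D ≡ a (2ᵏ)} (#Cl₃(D) − 2)| ≤ ε X`. Classes containing no
fundamental discriminant (`a ≢ 1 (4)`, `a ≢ 8, 12 (16)`) have empty sums; the others are classes of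
an admissible type `(r, s)` = `(1, a mod 8)`, `(4, a/4 mod 8)`, `(8, a/8 mod 8)`. -/
theorem progression_eventually_of_le
    (hA : ∀ r ∈ ({1, 4, 8} : Finset ℕ), ∀ s ∈ ({1, 3, 5, 7} : Finset ℤ),
      ttLocalFactorTwo (r * s) = 1 → ∃ K : ℝ, ∀ ε : ℝ, 0 < ε → ∃ C : ℝ, ∀ X : ℕ, 1 ≤ X →
        |(∑ D ∈ (negFundDiscrs X).filter (fun D => D ≡ r * s [ZMOD ((8 * r : ℕ) : ℤ)]),
            (quadFieldThreeTorsion D : ℝ)) - 2 / (r * Real.pi ^ 2) * X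
            - K * (X : ℝ) ^ ((5 : ℝ) / 6)| ≤ C * (X : ℝ) ^ ((18 : ℝ) / 23 + ε))
    (hB : ∀ r ∈ ({1, 4, 8} : Finset ℕ), ∀ s ∈ ({1, 3, 5, 7} : Finset ℤ),
      ttLocalFactorTwo (r * s) = 1 → ∀ (k : ℕ) (χ : DirichletCharacter ℂ (2 ^ k)), χ ^ 6 ≠ 1 →
        ∀ ε : ℝ, 0 < ε → ∃ C : ℝ, ∀ X : ℕ, 1 ≤ X →
          ‖∑ D ∈ (negFundDiscrs X).filter (fun D => D ≡ r * s [ZMOD ((8 * r : ℕ) : ℤ)]),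
              χ (((D / (r : ℤ) : ℤ)) : ZMod (2 ^ k)) * (((quadFieldThreeTorsion D : ℂ) - 1) / 2)‖
            ≤ C * (X : ℝ) ^ ((18 : ℝ) / 23 + ε))
    {k : ℕ} (hk : 6 ≤ k) (a : ℤ) {ε : ℝ} (hε : 0 < ε) :
    ∀ᶠ X : ℕ in atTop,
      |∑ D ∈ (negFundDiscrs X).filter (fun D => D ≡ a [ZMOD ((2 ^ k : ℕ) : ℤ)]),
          ((quadFieldThreeTorsion D : ℝ) - 2)| ≤ ε * X := by
  by_cases hadm : a % 4 = 1 ∨ a % 16 = 12 ∨ a % 16 = 8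
  · rcases hadm with h1 | h12 | h8
    · -- type `(1, a mod 8)`
      refine progression_eventually_of_type hA hB (r := 1) (s := a % 8) (j := k) (b := a)
        (by simp) ?_ ?_ hk (by ring) (by ring) ?_ hε
      · have : a % 8 = 1 ∨ a % 8 = 5 := by omega
        rcases this with h | h <;> rw [h] <;> simp
      · unfold ttLocalFactorTwo
        rw [if_pos]
        push_cast
        omega
      · rw [Int.ModEq, Int.emod_emod_of_dvd _ (by norm_num)]
    · -- type `(4, a/4 mod 8)`
      refine progression_eventually_of_type hA hB (r := 4) (s := a / 4 % 8) (j := k - 2) (b := a / 4)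
        (by simp) ?_ ?_ hk ?_ ?_ ?_ hε
      · have : a / 4 % 8 = 3 ∨ a / 4 % 8 = 7 := by omega
        rcases this with h | h <;> rw [h] <;> simp
      · unfold ttLocalFactorTwo
        rw [if_pos]
        push_cast
        omega
      · rw [show (4:ℕ) = 2 ^ 2 by norm_num, ← pow_add]
        congr 1
        omega
      · push_cast
        omega
      · rw [Int.ModEq, Int.emod_emod_of_dvd _ (by norm_num)]
    · -- type `(8, a/8 mod 8)`
      refine progression_eventually_of_type hA hB (r := 8) (s := a / 8 % 8) (j := k - 3) (b := a / 8)
        (by simp) ?_ ?_ hk ?_ ?_ ?_ hε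
      · have : a / 8 % 8 = 1 ∨ a / 8 % 8 = 3 ∨ a / 8 % 8 = 5 ∨ a / 8 % 8 = 7 := by omega
        rcases this with h | h | h | h <;> rw [h] <;> simp
      · unfold ttLocalFactorTwo
        rw [if_pos]
        push_cast
        omega
      · rw [show (8:ℕ) = 2 ^ 3 by norm_num, ← pow_add]
        congr 1
        omega
      · push_cast
        omega
      · rw [Int.ModEq, Int.emod_emod_of_dvd _ (by norm_num)]
  · -- no fundamental discriminant in the class
    push Not at hadm
    refine Filter.Eventually.of_forall fun X => ?_
    rw [negFundDiscrs_filter_modEq_eq_empty ((pow_dvd_pow 2 (show 4 ≤ k by omega)).trans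
      (by norm_num)) hadm.1 hadm.2.1 hadm.2.2, Finset.sum_empty, abs_zero]
    positivity

/-- **Mean `2` in every class `mod 2ᵏ` (Davenport–Heilbronn in the binary progressions), from
Taniguchi–Thorne at the prime `2`.** For every `k`, every `a` and every `ε > 0`: eventually in `X`,
`|Σ_{D ∈ negFundDiscrs X, D ≡ a (mod 2ᵏ)} (#Cl₃(D) − 2)| ≤ ε X`. For `k < 6` the class is split
into `2⁶⁻ᵏ` classes `mod 64`. -/
theorem progression_eventually
    (hA : ∀ r ∈ ({1, 4, 8} : Finset ℕ), ∀ s ∈ ({1, 3, 5, 7} : Finset ℤ),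
      ttLocalFactorTwo (r * s) = 1 → ∃ K : ℝ, ∀ ε : ℝ, 0 < ε → ∃ C : ℝ, ∀ X : ℕ, 1 ≤ X →
        |(∑ D ∈ (negFundDiscrs X).filter (fun D => D ≡ r * s [ZMOD ((8 * r : ℕ) : ℤ)]),
            (quadFieldThreeTorsion D : ℝ)) - 2 / (r * Real.pi ^ 2) * X
            - K * (X : ℝ) ^ ((5 : ℝ) / 6)| ≤ C * (X : ℝ) ^ ((18 : ℝ) / 23 + ε))
    (hB : ∀ r ∈ ({1, 4, 8} : Finset ℕ), ∀ s ∈ ({1, 3, 5, 7} : Finset ℤ),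
      ttLocalFactorTwo (r * s) = 1 → ∀ (k : ℕ) (χ : DirichletCharacter ℂ (2 ^ k)), χ ^ 6 ≠ 1 →
        ∀ ε : ℝ, 0 < ε → ∃ C : ℝ, ∀ X : ℕ, 1 ≤ X →
          ‖∑ D ∈ (negFundDiscrs X).filter (fun D => D ≡ r * s [ZMOD ((8 * r : ℕ) : ℤ)]),
              χ (((D / (r : ℤ) : ℤ)) : ZMod (2 ^ k)) * (((quadFieldThreeTorsion D : ℂ) - 1) / 2)‖
            ≤ C * (X : ℝ) ^ ((18 : ℝ) / 23 + ε))
    (k : ℕ) (a : ℤ) {ε : ℝ} (hε : 0 < ε) :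
    ∀ᶠ X : ℕ in atTop,
      |∑ D ∈ (negFundDiscrs X).filter (fun D => D ≡ a [ZMOD ((2 ^ k : ℕ) : ℤ)]),
          ((quadFieldThreeTorsion D : ℝ) - 2)| ≤ ε * X := by
  rcases Nat.lt_or_ge k 6 with hk | hk
  swap
  · exact progression_eventually_of_le hA hB hk a hε
  · -- split the class `mod 2ᵏ` into `q = 2⁶⁻ᵏ` classes `mod 64`
    set q := 2 ^ (6 - k) with hq
    have hq0 : 0 < q := by positivity
    have hkq : 2 ^ k * q = 2 ^ 6 := by rw [hq, ← pow_add]; congr 1; omega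
    have hε' : 0 < ε / q := by positivity
    have hsub : ∀ i : ℕ, ∀ᶠ X : ℕ in atTop,
        |∑ D ∈ (negFundDiscrs X).filter
            (fun D => D ≡ a + ((2 ^ k : ℕ) : ℤ) * i [ZMOD ((2 ^ k * q : ℕ) : ℤ)]),
          ((quadFieldThreeTorsion D : ℝ) - 2)| ≤ ε / q * X := by
      intro i
      rw [hkq]
      exact progression_eventually_of_le hA hB le_rfl _ hε'
    have hall := (Filter.eventually_all_finset (Finset.range q)).mpr fun i _ => hsub i
    filter_upwards [hall] with X hX
    rw [sum_filter_modEq_eq_sum_sum_filter_modEq (by positivity) hq0 (negFundDiscrs X) a]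
    calc |∑ i ∈ Finset.range q, ∑ D ∈ (negFundDiscrs X).filter
            (fun D => D ≡ a + ((2 ^ k : ℕ) : ℤ) * i [ZMOD ((2 ^ k * q : ℕ) : ℤ)]),
            ((quadFieldThreeTorsion D : ℝ) - 2)|
        ≤ ∑ i ∈ Finset.range q, |∑ D ∈ (negFundDiscrs X).filter
            (fun D => D ≡ a + ((2 ^ k : ℕ) : ℤ) * i [ZMOD ((2 ^ k * q : ℕ) : ℤ)]),
            ((quadFieldThreeTorsion D : ℝ) - 2)| := Finset.abs_sum_le_sum_abs _ _
      _ ≤ ∑ _i ∈ Finset.range q, ε / q * X := Finset.sum_le_sum fun i hi => hX i hi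
      _ = ε * X := by
          rw [Finset.sum_const, Finset.card_range, nsmul_eq_mul]
          have : (q : ℝ) ≠ 0 := by positivity
          field_simp

end Summit.QuantumAdvantage.QuantumAdvantage.Theorems.ArithStatLadder

end
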